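import Mathlib.FieldTheory.Galois.Infinite
import Mathlib.FieldTheory.Normal.Closure
import Literature.AlgebraicGeometry.Frobenioids.FinSubextCat
import Literature.AlgebraicGeometry.Frobenioids.CategoriesFactorization
import HarnessLib

/-!
# Frobenioids I, §6: every monomorphism of `D = B(G)⁰` is an isomorphism; `D` is of FSM-type
# (Theorem 6.2 (iii) / Theorem 6.4 (i), base-category clause of "standard type") — PROOF

Mochizuki, *The geometry of Frobenioids I*, Kyushu J. Math. **62** (2008), proof of Thm. 6.2 (iii), kurims
text p. 111: "It is immediate that every monomorphism of `D` is an isomorphism, hence that `D` is of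
FSM-type [hence also of FSMFF-type — cf. §0]"; proof of Thm. 6.4 (i), p. 115: "As was observed in the
proof of Theorem 6.2, (iii), (iv), `D` is Frobenius-slim and of FSM-type, hence also of FSMFF-type" —
this is clause (d) of "standard type" (Def. 3.1 (i)). [cite: MochizukiFrdI2008, Thm. 6.2 (iii) p.111]

PROOF-ONLY companion (abc-iut-L6-t10, D-ζ-c) over abc-iut-L1-t3's `FinSubextCat` (`D` for a Galois
extension `K/F`: finite subextensions, `Hom(Spec L, Spec M) = Hom_F(M, L)`) and the tree's `IsOfFSMType` /
`IsOfFSMFFType` (`Categories.lean`, `CategoriesFactorization.lean`). PROVED: `isIso_of_mono` (a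
monomorphism `Spec L → Spec M` is given by a SURJECTIVE `M → L`: otherwise two embeddings of `L` into its
normal closure agree on the image of `M` — Galois correspondence for `K/F` — contradicting cancellation),
`isOfFSMType`, `isOfFSMFFType`.
-/

noncomputable section

namespace Literature.AlgebraicGeometry.Frobenioids

open CategoryTheory IntermediateField

universe u

namespace FinSubextCat

variable {F : Type u} [Field F] {K : Type u} [Field K] [Algebra F K]

/-- A morphism of `D` whose underlying algebra map is bijective is an isomorphism.
[cite: MochizukiFrdI2008, Thm. 6.2 (iii) p.111] -/
theorem isIso_of_bijective {X Y : FinSubextCat F K} (f : X ⟶ Y)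
    (hf : Function.Bijective f.toAlgHom) : IsIso f := by
  let e : Y.L ≃ₐ[F] X.L := AlgEquiv.ofBijective f.toAlgHom hf
  refine ⟨⟨⟨(e.symm : X.L →ₐ[F] Y.L)⟩, ?_, ?_⟩⟩
  · exact hom_ext (AlgHom.ext fun x => e.apply_symm_apply x)
  · exact hom_ext (AlgHom.ext fun y => e.symm_apply_apply y)

/-- An element of `Gal(K/F)` maps a normal intermediate field into itself. [folklore] -/
private theorem apply_mem_of_normal' (E : IntermediateField F K) [Normal F E] (g : K ≃ₐ[F] K)
    {x : K} (hx : x ∈ E) : g x ∈ E := by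
  have h := AlgHom.fieldRange_of_normal ((g : K →ₐ[F] K).comp E.val)
  have hmem : g x ∈ ((g : K →ₐ[F] K).comp E.val).fieldRange :=
    AlgHom.mem_fieldRange.mpr ⟨⟨x, hx⟩, rfl⟩
  rwa [h] at hmem

variable [IsGalois F K]

/-- **Theorem 6.2 (iii) / 6.4 (i), proof, p. 111**: "every monomorphism of `D` is an isomorphism" —
PROVED for `D = FinSubextCat F K`, `K/F` Galois: the algebra map `M → L` underlying a monomorphism
`Spec L → Spec M` is surjective (if `x ∈ L` is not in the image, the Galois correspondence for `K/F`
gives `σ ∈ Gal(K/F)` fixing the image and moving `x`; the inclusion of `L` into its normal closure `N`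
and its `σ`-twist are two distinct arrows `Spec N → Spec L` equalised by the monomorphism).
[cite: MochizukiFrdI2008, Thm. 6.2 (iii) p.111] -/
theorem isIso_of_mono {X Y : FinSubextCat F K} (f : X ⟶ Y) [Mono f] : IsIso f := by
  have hinj : Function.Injective f.toAlgHom := (f.toAlgHom : Y.L →+* X.L).injective
  refine isIso_of_bijective f ⟨hinj, fun x => ?_⟩
  by_contra hx
  push Not at hx
  -- the image of `M = Y.L` inside `K`, an intermediate field contained in `X.L`
  let M' : IntermediateField F K := (X.L.val.comp f.toAlgHom).fieldRange
  have hxM : (x : K) ∉ M' := by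
    intro h
    obtain ⟨y, hy⟩ := AlgHom.mem_fieldRange.mp h
    exact hx y (Subtype.ext hy)
  -- Galois correspondence: some `σ` fixing `M'` moves `x`
  obtain ⟨σ, hσM, hσx⟩ : ∃ σ ∈ M'.fixingSubgroup, σ (x : K) ≠ x := by
    by_contra h
    push Not at h
    apply hxM
    rw [← InfiniteGalois.fixedField_fixingSubgroup M', IntermediateField.mem_fixedField_iff]
    exact h
  -- the normal closure `N` of `X.L` and the two arrows `Spec N → Spec X.L`
  let N : IntermediateField F K := normalClosure F X.L K
  haveI : FiniteDimensional F N := normalClosure.is_finiteDimensional F X.L K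
  haveI : Normal F N := normalClosure.normal F X.L K
  have hXN : X.L ≤ N := IntermediateField.le_normalClosure _
  let W : FinSubextCat F K := ⟨N⟩
  let g₁ : W ⟶ X := ⟨IntermediateField.inclusion hXN⟩
  let τ : X.L →ₐ[F] N :=
    { toFun := fun a => ⟨σ a, apply_mem_of_normal' N σ (hXN a.2)⟩
      map_one' := Subtype.ext (by simp)
      map_mul' := fun a b => Subtype.ext (by simp)
      map_zero' := Subtype.ext (by simp)
      map_add' := fun a b => Subtype.ext (by simp)
      commutes' := fun r => Subtype.ext (by simp) }
  let g₂ : W ⟶ X := ⟨τ⟩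
  have heq : g₁ ≫ f = g₂ ≫ f := by
    refine hom_ext (AlgHom.ext fun y => Subtype.ext ?_)
    show ((f.toAlgHom y : X.L) : K) = σ ((f.toAlgHom y : X.L) : K)
    exact ((IntermediateField.mem_fixingSubgroup_iff M' σ).mp hσM _
      (AlgHom.mem_fieldRange.mpr ⟨y, rfl⟩)).symm
  have hg : g₁ = g₂ := (cancel_mono f).mp heq
  have := congrArg (fun g : W ⟶ X => ((g.toAlgHom x : N) : K)) hg
  exact hσx this.symm

variable (F K) in
/-- **Theorem 6.2 (iii) / 6.4 (i), proof** (FrdI p. 111, p. 115): "`D` is of FSM-type" — PROVED for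
`D = FinSubextCat F K`, `K/F` Galois. [cite: MochizukiFrdI2008, Thm. 6.2 (iii) p.111] -/
theorem isOfFSMType : IsOfFSMType (FinSubextCat F K) :=
  ⟨fun f hf => by haveI := hf.2; exact isIso_of_mono f⟩

variable (F K) in
/-- **Theorem 6.2 (iii) / 6.4 (i), proof** (FrdI p. 111: "[hence also of FSMFF-type — cf. §0]"; this is
clause (d) of "standard type", Def. 3.1 (i)) — PROVED for `D = FinSubextCat F K`, `K/F` Galois.
[cite: MochizukiFrdI2008, Thm. 6.2 (iii) p.111] -/
theorem isOfFSMFFType : IsOfFSMFFType (FinSubextCat F K) :=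
  (isOfFSMType F K).isOfFSMFFType

end FinSubextCat

end Literature.AlgebraicGeometry.Frobenioids

end
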